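import Summits.NavierStokesRegularity.NavierStokesRegularity.Theorems.ExtremiserTransienceLocalMaximiserEulerLagrange
import Summits.NavierStokesRegularity.NavierStokesRegularity.Theorems.ExtremiserTransienceTwoThirdsLayerComparison
import HarnessLib

/-!
# Route `ExtremiserTransience`, crux `NearExtremalTransiencePerFlow` (stmt-NavierStokesRegularity-26567), LINE g10-1 «two_thirds»
# (ns-idea-10 g10), stub S2 `FirstOrderIdentity`: THE REDUCTION IDENTITY — S2 is two estimates

Helper file for S2 (`--supports stmt-NavierStokesRegularity-26567`).  For a field `V` of the limit class, a smooth compactly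
supported scalar weight `χ` equal to `1` on an open set `P` (in S2: `P = B(c,R)`), and ANY smooth vector field `ψ` (in S2: the
Biot–Savart gauge `K ∗ (ζV)`, whose curl is `V − ∇q` on the support of `χ`), the Euler–Lagrange identity of the limit class
(`eulerLagrange_of_inLimitClass`, applied to the compactly supported potential `χψ`) and the layer formula (`a1_layer`, applied to
the direction `φ₀ = χ·curl ψ − χV − curl(χψ) = −(χV + ∇χ×ψ)`, which equals `−V` on `P`) give the EXACT identity

  `3·J_{χ²} − 2·K_{χ²} = ∫_{Pᶜ} (f₁(φ₀) + χ²(3·sd − κ⋆(zd + wd))) + a₁(χ·(V − curl ψ))`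

(`three_Jg_sub_two_Kg_eq`): the weighted two-thirds defect is a LAYER integral plus the first variation along the REMAINDER
direction `χ(V − curl ψ)` (for the gauge: `χ∇q`, the harmonic remainder).  S2 is thereby reduced to two estimates — the layer
junk (card: J1–J4) and the remainder term — plus the layer comparison of `…TwoThirdsLayerComparison`.
Also: `a1_zero`, the smoothness/support facts of `φ₀`, and `curl(χψ) = −φ₀ − χ(V − curl ψ)`.

HONEST FRAMING: an identity of the variational calculus of the local gain; nothing about Navier–Stokes regularity or blow-up is
proved; S2, the crux ⟨26567⟩ and NS regularity are OPEN; no summit is proved by a line. [folklore]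
-/

noncomputable section

open scoped Topology InnerProductSpace RealInnerProductSpace ENNReal ContDiff
open MeasureTheory Filter Set Metric
open Literature.Analysis.FluidPDE
open Summit.NavierStokesRegularity.NavierStokesRegularity.Theorems.DepletionLadder.KStar.HalfSpace
open Summit.NavierStokesRegularity.NavierStokesRegularity.Theorems.DepletionLadder
open Summit.NavierStokesRegularity.NavierStokesRegularity.Theorems.NearExtremalTransiencePerFlow.LocalMaximiser

namespace Summit.NavierStokesRegularity.NavierStokesRegularity.Theorems.NearExtremalTransiencePerFlow.TwoThirds

-- the summit's namespace repeats the problem name by convention (D-0017)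
set_option linter.dupNamespace false

variable {V ψ : E3 → E3} {χ : E3 → ℝ}

/-- The first variation along the zero direction vanishes. [folklore] -/
theorem a1_zero (κ μ : ℝ) (V : E3 → E3) : a1 κ μ V 0 = 0 := by
  have hc : ∀ x, c1 V 0 x = 0 := fun x => by
    unfold c1
    simp [curl_zero]
  have hz : ∀ x, z1 V 0 x = 0 := fun x => by
    unfold z1
    simp [curl_zero]
  have hw : ∀ x, w1 V 0 x = 0 := fun x => by
    unfold w1
    have h0 : curl (0 : E3 → E3) = 0 := funext fun y => curl_zero y
    simp [h0]
  unfold a1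
  simp [hc, hz, hw]

/-- The product rule for the curl in the form used here: `curl(χψ) = χ·curl ψ + (curl(χψ) − χ·curl ψ)`, i.e.
`curl(χψ) = −φ₀ − χ(V − curl ψ)` with `φ₀ = χ·curl ψ − χV − curl(χψ)`. -/
theorem curl_smul_eq_neg_sub (x : E3) :
    curl (fun y => χ y • ψ y) x =
      -(χ x • curl ψ x - χ x • V x - curl (fun y => χ y • ψ y) x) - χ x • (V x - curl ψ x) := by
  rw [smul_sub]
  abel

/-- `φ₀ = χ·curl ψ − χV − curl(χψ)` is smooth. [folklore] -/
theorem contDiff_phi0 (hV : ContDiff ℝ (⊤ : ℕ∞) V) (hχ : ContDiff ℝ (⊤ : ℕ∞) χ) (hψ : ContDiff ℝ (⊤ : ℕ∞) ψ) :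
    ContDiff ℝ (⊤ : ℕ∞) fun x => χ x • curl ψ x - χ x • V x - curl (fun y => χ y • ψ y) x :=
  ((hχ.smul (contDiff_curl (n := ⊤) hψ)).sub (hχ.smul hV)).sub (contDiff_curl (n := ⊤) (hχ.smul hψ))

/-- `φ₀` has compact support (inside the support of `χ`). [folklore] -/
theorem hasCompactSupport_phi0 (hχc : HasCompactSupport χ) :
    HasCompactSupport fun x => χ x • curl ψ x - χ x • V x - curl (fun y => χ y • ψ y) x :=
  ((hχc.smul_right (f' := curl ψ)).sub (hχc.smul_right (f' := V))).sub
    (hasCompactSupport_curl (hχc.smul_right (f' := ψ)))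

/-- On the plateau `P` (open, `χ = 1`): `φ₀ = −V`. [folklore] -/
theorem phi0_eq_neg_of_mem {P : Set E3} (hP : IsOpen P)
    (hχP : ∀ x ∈ P, χ x = 1) {x : E3} (hx : x ∈ P) :
    χ x • curl ψ x - χ x • V x - curl (fun y => χ y • ψ y) x = -V x := by
  -- `χψ = ψ` near `x`, so their curls agree at `x`
  have hloc : (fun y => χ y • ψ y) =ᶠ[𝓝 x] ψ := by
    filter_upwards [hP.mem_nhds hx] with y hy
    rw [hχP y hy, one_smul]
  have hcurl : curl (fun y => χ y • ψ y) x = curl ψ x := by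
    simp only [curl, hloc.fderiv_eq]
  rw [hcurl, hχP x hx, one_smul, one_smul]
  abel

/-- **THE REDUCTION IDENTITY OF S2.**  `V` in the limit class, `χ` a smooth compactly supported weight equal to `1` on the open
set `P`, `ψ` any smooth field; with `φ₀ := χ·curl ψ − χV − curl(χψ)` (`= −V` on `P`):
`3J_{χ²} − 2K_{χ²} = ∫_{Pᶜ} (f₁(φ₀) + χ²(3·sd − κ⋆(zd + wd))) + a₁(χ(V − curl ψ))`.
Proof: Euler–Lagrange on the potential `χψ` (`a₁(curl(χψ)) = 0`), `curl(χψ) = −φ₀ − χ(V − curl ψ)`, additivity of `a₁`, and the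
layer formula `a1_layer` for `φ₀`. [folklore] -/
theorem three_Jg_sub_two_Kg_eq {A : ℕ → ℝ} {A_E : ℝ} (hV : InLimitClass A A_E V)
    (hχ : ContDiff ℝ (⊤ : ℕ∞) χ) (hχc : HasCompactSupport χ) {P : Set E3} (hP : IsOpen P)
    (hχP : ∀ x ∈ P, χ x = 1) (hψ : ContDiff ℝ (⊤ : ℕ∞) ψ) :
    3 * Jg χ V - 2 * Kg χ V =
      (∫ x in Pᶜ, (f1 V (fun y => χ y • curl ψ y - χ y • V y - curl (fun z => χ z • ψ z) y) x +
          χ x ^ 2 * (3 * sd V x - kStar * (zd V x + wd V x)))) +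
        a1 kStar 1 V (fun y => χ y • (V y - curl ψ y)) := by
  have hVs : ContDiff ℝ (⊤ : ℕ∞) V := hV.2.1
  -- the three directions
  set φ₀ : E3 → E3 := fun y => χ y • curl ψ y - χ y • V y - curl (fun z => χ z • ψ z) y with hφ₀def
  set r : E3 → E3 := fun y => χ y • (V y - curl ψ y) with hrdef
  have hφ₀ : ContDiff ℝ (⊤ : ℕ∞) φ₀ := contDiff_phi0 hVs hχ hψ
  have hφ₀c : HasCompactSupport φ₀ := hasCompactSupport_phi0 hχc
  have hr : ContDiff ℝ (⊤ : ℕ∞) r := hχ.smul (hVs.sub (contDiff_curl (n := ⊤) hψ))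
  have hrc : HasCompactSupport r := hχc.smul_right (f' := fun y => V y - curl ψ y)
  have hη : ContDiff ℝ (⊤ : ℕ∞) fun y => χ y • ψ y := hχ.smul hψ
  have hηc : HasCompactSupport fun y => χ y • ψ y := hχc.smul_right (f' := ψ)
  -- Euler–Lagrange on the potential `χψ`
  have hEL : a1 kStar 1 V (curl fun y => χ y • ψ y) = 0 := eulerLagrange_of_inLimitClass hV hη hηc
  -- `curl(χψ) + (φ₀ + r) = 0`
  have hsum : (curl fun y => χ y • ψ y) + (φ₀ + r) = 0 := by
    funext x
    simp only [Pi.add_apply, Pi.zero_apply, hφ₀def, hrdef, smul_sub]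
    abel
  have hcs : ContDiff ℝ (⊤ : ℕ∞) (curl fun y => χ y • ψ y) := contDiff_curl (n := ⊤) hη
  have hcc : HasCompactSupport (curl fun y => χ y • ψ y) := hasCompactSupport_curl hηc
  have hsplit : a1 kStar 1 V (curl fun y => χ y • ψ y) + (a1 kStar 1 V φ₀ + a1 kStar 1 V r) = 0 := by
    rw [← a1_add hVs hφ₀ hφ₀c hr hrc, ← a1_add (φ' := φ₀ + r) hVs hcs hcc (hφ₀.add hr) (hφ₀c.add hrc), hsum, a1_zero]
  rw [hEL, zero_add] at hsplit
  -- the layer formula for `φ₀`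
  have hlayer := a1_layer hVs hφ₀ hφ₀c hχ.continuous hχc hP hχP
    (fun x hx => phi0_eq_neg_of_mem hP hχP hx)
  linarith

end Summit.NavierStokesRegularity.NavierStokesRegularity.Theorems.NearExtremalTransiencePerFlow.TwoThirds

end
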